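import Summits.Ventures.DiscreteObjects.PP12.OrderElevenHomologyKernel
import Summits.Ventures.DiscreteObjects.PP12.OrderElevenHomologyNormal

/-!
# PP(12), order-11 cell, Case A: SOUNDNESS of the compatibility scan (designs g22)
Framing: lottery ticket; floor = certified bounds/negative ranges.

Cell pub-namedobj (venture DiscreteObjects), target (M), P11-SIZING.md. The rows of a normal array (`Homology12.IsNormal`, `OrderElevenHomologyNormal`) are
packed base 16 (`packRow`); the kernel test `compat` (`OrderElevenHomologyKernel`) reads the digits back (`dg_packRow`) and accepts the rows `1` and `2` of every
normal array (`compat_packRow`: the differences are non-zero — `IsNormal.ne_of_ne` — and pairwise distinct — `IsNormal.diff_ne`); hence a successful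
`blockedAll reps cands` excludes every normal array whose row `1` is listed in `reps` and whose row `2` is listed in `cands` (`false_of_blockedAll`).
No `sorry`, no new axioms; nothing here asserts a census statement. (designs g24: file-level `maxRecDepth` for the `decide` on the 363-row literal `REPS`,
as in the sibling modules — the first filing p390819 bounced on it.)
-/

set_option maxRecDepth 100000

namespace Summit.Ventures.DiscreteObjects.PP12

namespace Homology12

open Finset

/-! ### base-16 packing -/

/-- `Σ_{k<n} F k · 16^k` -/
def pack16 (F : ℕ → ℕ) : ℕ → ℕ
  | 0 => 0
  | n + 1 => pack16 F n + F n * 16 ^ n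

/-- a packing with digits `< 16` is below `16^n` -/
theorem pack16_lt {F : ℕ → ℕ} {n : ℕ} (h : ∀ i < n, F i < 16) : pack16 F n < 16 ^ n := by
  induction n with
  | zero => simp [pack16]
  | succ n ih =>
    rw [pack16, pow_succ]
    have h1 := ih fun i hi => h i (by omega)
    have h2 : F n ≤ 15 := by have := h n (by omega); omega
    have := Nat.mul_le_mul_right (16 ^ n) h2
    omega

/-- the lowest digit first -/
theorem pack16_succ' (F : ℕ → ℕ) (n : ℕ) : pack16 F (n + 1) = F 0 + 16 * pack16 (fun i => F (i + 1)) n := by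
  induction n with
  | zero => simp [pack16]
  | succ n ih => rw [pack16, ih, pack16]; ring

/-- splitting a packing at digit `k` -/
theorem pack16_split (F : ℕ → ℕ) (k m : ℕ) : pack16 F (k + m) = pack16 F k + 16 ^ k * pack16 (fun i => F (k + i)) m := by
  induction m with
  | zero => simp [pack16]
  | succ m ih => rw [Nat.add_succ, pack16, ih, pack16, pow_add]; ring

/-- **reading a digit**: with all digits `< 16`, digit `k` of the packing is `F k` -/
theorem pack16_div_mod {F : ℕ → ℕ} {n k : ℕ} (h : ∀ i < n, F i < 16) (hk : k < n) : pack16 F n / 16 ^ k % 16 = F k := by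
  obtain ⟨m, rfl⟩ : ∃ m, n = k + (m + 1) := ⟨n - k - 1, by omega⟩
  rw [pack16_split, pack16_succ']
  have hlow : pack16 F k < 16 ^ k := pack16_lt fun i hi => h i (by omega)
  rw [show pack16 F k + 16 ^ k * (F (k + 0) + 16 * pack16 (fun i => F (k + (i + 1))) m) =
      pack16 F k + 16 ^ k * (F k + 16 * pack16 (fun i => F (k + (i + 1))) m) by simp]
  rw [Nat.add_mul_div_left _ _ (by positivity), Nat.div_eq_of_lt hlow, zero_add, Nat.add_mul_mod_self_left]
  exact Nat.mod_eq_of_lt (h k (by omega))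

/-- `dg` reads base-16 digits -/
theorem dg_eq (x j : ℕ) : dg x j = x / 16 ^ j % 16 := by
  unfold dg
  rw [Nat.shiftRight_eq_div_pow, pow_mul, show (2 : ℕ) ^ 4 = 16 by norm_num, show (15 : ℕ) = 2 ^ 4 - 1 from rfl, Nat.and_two_pow_sub_one_eq_mod]

/-! ### packed rows of an array -/

/-- the digit function of row `i` of an array: entry values, `0` at the hole and beyond `12` -/
def rowDigit (a : Fin 12 → Fin 12 → ZMod 11) (i : Fin 12) (k : ℕ) : ℕ :=
  if h : k < 12 then (if (⟨k, h⟩ : Fin 12) = i then 0 else (a i ⟨k, h⟩).val) else 0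

/-- the digits are `< 16` -/
theorem rowDigit_lt (a : Fin 12 → Fin 12 → ZMod 11) (i : Fin 12) (k : ℕ) : rowDigit a i k < 16 := by
  unfold rowDigit
  split_ifs with h1 h2
  · norm_num
  · have := (a i ⟨k, h1⟩).val_lt; omega
  · norm_num

/-- **the packed row** `i` of an array (base 16, hole digit `0`) -/
def packRow (a : Fin 12 → Fin 12 → ZMod 11) (i : Fin 12) : ℕ := pack16 (rowDigit a i) 12

/-- reading an entry off the hole from the packed row -/
theorem dg_packRow (a : Fin 12 → Fin 12 → ZMod 11) (i j : Fin 12) (hji : j ≠ i) : dg (packRow a i) j = (a i j).val := by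
  rw [dg_eq, packRow, pack16_div_mod (fun k _ => rowDigit_lt a i k) j.2, rowDigit, dif_pos j.2]
  simp [hji]

/-- the kernel's difference of two packed entries is the value of the `ZMod 11` difference -/
theorem diff_val (x y : ZMod 11) : (x.val + 11 - y.val) % 11 = (x - y).val := by
  have h1 : x.val = ((x - y).val + y.val) % 11 := by rw [← ZMod.val_add, sub_add_cancel]
  have h2 := (x - y).val_lt
  have h3 := y.val_lt
  omega

/-! ### soundness of the compatibility pass -/

/-- the difference digit tested by `cgo` at column `j` -/
def dd (r s j : ℕ) : ℕ := (dg r j + 11 - dg s j) % 11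

/-- **the pass succeeds** when, on the columns still to come (off the holes), the difference digits are non-zero, not yet used, and pairwise distinct -/
theorem cgo_true (r s i i' : ℕ) : ∀ (f j used : ℕ),
    (∀ j₁, j ≤ j₁ → j₁ < j + f → j₁ ≠ i → j₁ ≠ i' →
      dd r s j₁ ≠ 0 ∧ used.testBit (dd r s j₁) = false ∧ ∀ j₂, j ≤ j₂ → j₂ < j₁ → j₂ ≠ i → j₂ ≠ i' → dd r s j₂ ≠ dd r s j₁) →
    cgo r s i i' f j used = true
  | 0, _, _, _ => rfl
  | f + 1, j, used, h => by
    rw [cgo]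
    by_cases hj : j = i ∨ j = i'
    · have hc : ((j == i) || (j == i')) = true := by rcases hj with rfl | rfl <;> simp
      rw [if_pos hc]
      exact cgo_true r s i i' f (j + 1) used fun j₁ h1 h2 h3 h4 => by
        obtain ⟨a1, a2, a3⟩ := h j₁ (by omega) (by omega) h3 h4
        exact ⟨a1, a2, fun j₂ h5 h6 h7 h8 => a3 j₂ (by omega) h6 h7 h8⟩
    · push Not at hj
      have hc : ((j == i) || (j == i')) = false := by simp [hj.1, hj.2]
      rw [if_neg (by rw [hc]; exact Bool.false_ne_true)]
      obtain ⟨hne0, hbit, -⟩ := h j le_rfl (by omega) hj.1 hj.2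
      have hd : (dg r j + 11 - dg s j) % 11 = dd r s j := rfl
      simp only [hd]
      have hc2 : ((dd r s j == 0) || used.testBit (dd r s j)) = false := by simp [hne0, hbit]
      rw [if_neg (by rw [hc2]; exact Bool.false_ne_true)]
      refine cgo_true r s i i' f (j + 1) (used ||| (1 <<< dd r s j)) fun j₁ h1 h2 h3 h4 => ?_
      obtain ⟨a1, a2, a3⟩ := h j₁ (by omega) (by omega) h3 h4
      refine ⟨a1, ?_, fun j₂ h5 h6 h7 h8 => a3 j₂ (by omega) h6 h7 h8⟩
      have hne : dd r s j ≠ dd r s j₁ := a3 j le_rfl (by omega) hj.1 hj.2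
      rw [Nat.testBit_or, a2, Bool.false_or, Nat.one_shiftLeft, Nat.testBit_two_pow]
      simp [hne]

/-- **the rows `1` and `2` of a normal array are compatible** -/
theorem compat_packRow {a : Fin 12 → Fin 12 → ZMod 11} (ha : IsNormal a) : compat (packRow a 1) (packRow a 2) 1 2 = true := by
  unfold compat
  refine cgo_true _ _ 1 2 12 0 0 fun j₁ _ h2 h3 h4 => ?_
  have hj₁ : j₁ < 12 := by omega
  have key : ∀ k (hk : k < 12), k ≠ 1 → k ≠ 2 → dd (packRow a 1) (packRow a 2) k = (a 1 ⟨k, hk⟩ - a 2 ⟨k, hk⟩).val := by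
    intro k hk hk1 hk2
    have n1 : (⟨k, hk⟩ : Fin 12) ≠ 1 := fun e => hk1 (by simpa using congrArg Fin.val e)
    have n2 : (⟨k, hk⟩ : Fin 12) ≠ 2 := fun e => hk2 (by simpa using congrArg Fin.val e)
    have e1 : dg (packRow a 1) k = (a 1 ⟨k, hk⟩).val := dg_packRow a 1 ⟨k, hk⟩ n1
    have e2 : dg (packRow a 2) k = (a 2 ⟨k, hk⟩).val := dg_packRow a 2 ⟨k, hk⟩ n2
    rw [dd, e1, e2, diff_val]
  have n1 : (⟨j₁, hj₁⟩ : Fin 12) ≠ 1 := fun e => h3 (by simpa using congrArg Fin.val e)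
  have n2 : (⟨j₁, hj₁⟩ : Fin 12) ≠ 2 := fun e => h4 (by simpa using congrArg Fin.val e)
  refine ⟨?_, by simp, fun j₂ _ h6 h7 h8 => ?_⟩
  · rw [key j₁ hj₁ h3 h4]
    have := ha.ne_of_ne 1 2 ⟨j₁, hj₁⟩ (by decide) n1 n2
    rw [ne_eq, ZMod.val_eq_zero, sub_eq_zero]
    exact this
  · have hj₂ : j₂ < 12 := by omega
    have m1 : (⟨j₂, hj₂⟩ : Fin 12) ≠ 1 := fun e => h7 (by simpa using congrArg Fin.val e)
    have m2 : (⟨j₂, hj₂⟩ : Fin 12) ≠ 2 := fun e => h8 (by simpa using congrArg Fin.val e)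
    rw [key j₁ hj₁ h3 h4, key j₂ hj₂ h7 h8]
    intro e
    have e' := ZMod.val_injective 11 e
    exact ha.diff_ne 1 2 (by decide) ⟨j₂, hj₂⟩ ⟨j₁, hj₁⟩ (fun ee => by have := congrArg Fin.val ee; simp at this; omega) m1 m2 n1 n2 e'

/-- reading a `blockedAll` check: listed pairs are incompatible -/
theorem compat_false_of_blockedAll {reps cands : List ℕ} (h : blockedAll reps cands = true) {r s : ℕ} (hr : r ∈ reps) (hs : s ∈ cands) :
    compat r s 1 2 = false := by
  unfold blockedAll at h
  rw [List.all_eq_true] at h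
  have := h r hr
  rw [List.all_eq_true] at this
  have := this s hs
  simpa using this

/-- **what a scan proves**: no normal array has row `1` among `reps` and row `2` among `cands` -/
theorem false_of_blockedAll {reps cands : List ℕ} (h : blockedAll reps cands = true) {a : Fin 12 → Fin 12 → ZMod 11} (ha : IsNormal a)
    (hr : packRow a 1 ∈ reps) (hs : packRow a 2 ∈ cands) : False := by
  have := compat_false_of_blockedAll h hr hs
  rw [compat_packRow ha] at this
  exact Bool.noConfusion this

/-- **assembling the scan files**: if every slice `reps[20k, 20k+20)`, `k < m`, is blocked and `|reps| ≤ 20 m`, the whole list is blocked -/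
theorem blockedAll_of_slices {reps cands : List ℕ} (m : ℕ) (hm : reps.length ≤ 20 * m)
    (h : ∀ k < m, blockedAll ((reps.drop (20 * k)).take 20) cands = true) : blockedAll reps cands = true := by
  unfold blockedAll at h ⊢
  rw [List.all_eq_true]
  intro r hr
  obtain ⟨n, hn, rfl⟩ := List.getElem_of_mem hr
  have hk : n / 20 < m := by omega
  have hs := h (n / 20) hk
  rw [List.all_eq_true] at hs
  apply hs
  rw [List.mem_iff_getElem]
  refine ⟨n - 20 * (n / 20), ?_, ?_⟩
  · simp only [List.length_take, List.length_drop]; omega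
  · simp only [List.getElem_take, List.getElem_drop]; congr 1; omega

/-- the scans of `OrderElevenHomologyScanA/B` in the form used by `blockedAll_of_slices` (`REPS` has 363 rows: 19 slices of 20) -/
theorem reps_length : REPS.length ≤ 20 * 19 := by decide

end Homology12

end Summit.Ventures.DiscreteObjects.PP12
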